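import Mathlib
import Summits.Ventures.HodgeRepro.Tier4.Target
import Summits.Ventures.HodgeRepro.Tier4.Line3.Defs
import Summits.Ventures.HodgeRepro.Tier4.Line3.KMDatum
import Summits.Ventures.HodgeRepro.Tier4.Line3.KMDatumS
import Summits.Ventures.HodgeRepro.Tier4.Line3.SylvesterTransfer
import Summits.Ventures.HodgeRepro.Tier4.Line3.CopyWeightGaussian
import Summits.Ventures.HodgeRepro.Tier4.Line3.CopyWeightBoundShrinkRed
import Summits.Ventures.HodgeRepro.Tier4.Line3.CopyCountRay
import Summits.Ventures.HodgeRepro.Tier4.Line3.HKRayReduction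
import Summits.Ventures.HodgeRepro.Tier4.Line3.DatumOrthVanishing
import Summits.Ventures.HodgeRepro.Tier4.Line3.Transvection
import Summits.Ventures.HodgeRepro.Tier4.Line3.KMKernelForm
import Summits.Ventures.HodgeRepro.Tier4.Line3.KMDilation
import Summits.Ventures.HodgeRepro.Tier4.Line3.KMLaplace
import Summits.Ventures.HodgeRepro.Tier4.Line3.OrthPoint
import Summits.Ventures.HodgeRepro.Tier4.Line3.ConeAnn

/-!
# Tier4/Line3/KMLaplaceLower — the lower Laplace bound `J(ν) ≥ c ν^{−4}`

Blind re-derivation cell `pub-hodge-repro`, Tier 4 «PROVE THE STEP», LINE L3, seat t4-x2 (g4, reserve wall-breaker),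
cut C-L3-HKRAY: the lower half of the analysis of HKRAY-x2.md §5 in the kernel (`KMLaplaceLower` of KMLaplace).

At a symmetric centre whose plane is `J`-positive with independent first coordinates, let `z*` be the `J`-orthogonal point
(OrthPoint), `W(z*) = conj (det Y) ≠ 0` (KMKernelForm).  On the dilate `T_ν := z* + (r/√ν) · coneAnn` of a cone-annulus
(ConeAnn) with `r` small: `|f_j(z)| > κ R/2`, `0 < g ≤ 1`, `|W(z)|² > |W(z*)|²/4`, and `ν (m_0 + m_1) ≤ 4 r² L / g*`, so the
integrand `P_KM e^{−πν(m_0+m_1)} = |f_0 f_1|² g^{−4} |W|² e^{−πν(m_0+m_1)}` is `≥ c₃ R⁴` there, while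
`vol(T_ν) = R⁴ vol(coneAnn)`; hence `J(ν) ≥ c₃ vol(coneAnn) R⁸ = c ν^{−4}` (`R⁸ = r⁸/ν⁴`).

Nothing here says anything about the status of the Hodge conjecture for CM abelian varieties, which is NOT proved
(HC_CM is NOT proved by anyone in this repository).
-/

set_option autoImplicit false

noncomputable section

namespace Summit.Ventures.HodgeRepro.Tier4.Line3

open Summit.Ventures.HodgeRepro.Tier4
open Matrix MeasureTheory
open scoped ComplexConjugate

/-- `nsq` is continuous. -/
theorem continuous_nsq_low : Continuous nsq := by
  unfold nsq
  fun_prop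

/-- `z ↦ (lift3 z)^* J y` is continuous. -/
theorem continuous_jform_lift3_low (y : Fin 3 → ℂ) : Continuous (fun z : Fin 2 → ℂ => star (lift3 z) ⬝ᵥ (J *ᵥ y)) := by
  have : (fun z : Fin 2 → ℂ => star (lift3 z) ⬝ᵥ (J *ᵥ y)) = fun z => conj (z 0) * y 0 + conj (z 1) * y 1 - y 2 := by
    funext z
    rw [jform_eq]
    simp [lift3]
  rw [this]
  fun_prop

/-- `kmLin y · l` is continuous at every point of the ball. -/
theorem continuousAt_kmLin (y : Fin 3 → ℂ) {zs : Fin 2 → ℂ} (hzs : zs ∈ ball) (l : Fin 2) :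
    ContinuousAt (fun z => kmLin y z l) zs := by
  have hg : ((1 - nsq zs : ℝ) : ℂ) ≠ 0 := by
    have h : nsq zs < 1 := hzs
    exact_mod_cast (by linarith : (1 - nsq zs : ℝ) ≠ 0)
  unfold kmLin
  refine ContinuousAt.add continuousAt_const (ContinuousAt.mul (ContinuousAt.div ?_ ?_ hg) ?_)
  · exact (Complex.continuous_conj.comp (continuous_jform_lift3_low y)).continuousAt
  · exact (Complex.continuous_ofReal.comp (continuous_const.sub continuous_nsq_low)).continuousAt
  · exact (Complex.continuous_conj.comp (continuous_apply l)).continuousAt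

/-- `W = wedge (kmLin y0 ·) (kmLin y1 ·)` is continuous at every point of the ball. -/
theorem continuousAt_wedge_kmLin (y0 y1 : Fin 3 → ℂ) {zs : Fin 2 → ℂ} (hzs : zs ∈ ball) :
    ContinuousAt (fun z => wedge (kmLin y0 z) (kmLin y1 z)) zs := by
  unfold wedge
  exact ((continuousAt_kmLin y0 hzs 0).mul (continuousAt_kmLin y1 hzs 1)).sub
    ((continuousAt_kmLin y0 hzs 1).mul (continuousAt_kmLin y1 hzs 0))

namespace T4Data

variable (X : T4Data)

/-- `tauSize x = (y^* J y).re` when the form is positive. -/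
theorem tauSize_eq_re_of_pos (x : Fin 3 → X.E) (hx : 0 < (star (X.ballCoord x) ⬝ᵥ (J *ᵥ X.ballCoord x)).re) :
    X.tauSize x = (star (X.ballCoord x) ⬝ᵥ (J *ᵥ X.ballCoord x)).re := by
  unfold tauSize
  rw [← X.norm_ballCoord_J, norm_hformJ_eq_abs_re, abs_of_pos hx]

/-- `m_j = 2 |f_j|² / g` when the slot is `J`-positive. -/
theorem redMaj_eq (xm : X.Tuple) (j : Fin 4)
    (hx : 0 < (star (X.ballCoord (xm j)) ⬝ᵥ (J *ᵥ X.ballCoord (xm j))).re) (z : Fin 2 → ℂ) :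
    X.redMaj xm j z = 2 * ‖star (lift3 z) ⬝ᵥ (J *ᵥ X.ballCoord (xm j))‖ ^ 2 / (1 - nsq z) := by
  unfold redMaj maj
  rw [X.tauSize_eq_re_of_pos _ hx]
  ring

/-- **THE POINTWISE LOWER BOUND** of the KM integrand from lower bounds of its three factors. -/
theorem kmDilInt_ge (xm : X.Tuple) (h02 : xm 2 = xm 0) (h13 : xm 3 = xm 1) (ν : ℝ) (z : Fin 2 → ℂ)
    (hg0 : 0 < 1 - nsq z) (hg1 : 1 - nsq z ≤ 1) {A Bw E : ℝ} (hBw : 0 ≤ Bw) (hE : 0 ≤ E)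
    (hf : A ≤ Complex.normSq ((star (lift3 z) ⬝ᵥ (J *ᵥ X.ballCoord (xm 0))) *
      (star (lift3 z) ⬝ᵥ (J *ᵥ X.ballCoord (xm 1)))))
    (hW : Bw ≤ Complex.normSq (wedge (kmLin (X.ballCoord (xm 0)) z) (kmLin (X.ballCoord (xm 1)) z)))
    (hexp : E ≤ Real.exp (-(Real.pi * (ν * X.redMaj xm 0 z + ν * X.redMaj xm 1 z)))) :
    A * Bw * E ≤ X.kmDilInt xm ν ν z := by
  have hgf : X.kmGaussFree xm z =
      Complex.normSq ((star (lift3 z) ⬝ᵥ (J *ᵥ X.ballCoord (xm 0))) * (star (lift3 z) ⬝ᵥ (J *ᵥ X.ballCoord (xm 1)))) /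
        (1 - nsq z) ^ 4 * Complex.normSq (wedge (kmLin (X.ballCoord (xm 0)) z) (kmLin (X.ballCoord (xm 1)) z)) := by
    unfold kmGaussFree
    rw [X.kmKernel_symm xm h02 h13, Complex.ofReal_re, mul_assoc (_ * _), ← Real.exp_add]
    have : -(2 * Real.pi * (maj (X.ballCoord (xm 0)) z + maj (X.ballCoord (xm 1)) z)) +
        2 * Real.pi * (maj (X.ballCoord (xm 0)) z + maj (X.ballCoord (xm 1)) z) = 0 := by ring
    rw [this, Real.exp_zero, mul_one]
  have hdiv : A ≤ Complex.normSq ((star (lift3 z) ⬝ᵥ (J *ᵥ X.ballCoord (xm 0))) *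
      (star (lift3 z) ⬝ᵥ (J *ᵥ X.ballCoord (xm 1)))) / (1 - nsq z) ^ 4 := by
    refine hf.trans ?_
    rw [le_div_iff₀ (by positivity)]
    have h4 : (1 - nsq z) ^ 4 ≤ 1 := pow_le_one₀ hg0.le hg1
    exact mul_le_of_le_one_right (Complex.normSq_nonneg _) h4
  unfold kmDilInt
  rw [hgf]
  have hq0 : 0 ≤ Complex.normSq ((star (lift3 z) ⬝ᵥ (J *ᵥ X.ballCoord (xm 0))) *
      (star (lift3 z) ⬝ᵥ (J *ᵥ X.ballCoord (xm 1)))) / (1 - nsq z) ^ 4 :=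
    div_nonneg (Complex.normSq_nonneg _) (by positivity)
  exact mul_le_mul (mul_le_mul hdiv hW hBw hq0) hexp hE (mul_nonneg hq0 (Complex.normSq_nonneg _))

/-- The exponent bound on a small dilate: `ν (m_0 + m_1) ≤ 4 r² L / g*` when `|f_j| ≤ R L_j`, `g ≥ g*/2`, `ν R² = r²`. -/
theorem exp_bound_of_dilate (xm : X.Tuple)
    (hp0 : 0 < (star (X.ballCoord (xm 0)) ⬝ᵥ (J *ᵥ X.ballCoord (xm 0))).re)
    (hp1 : 0 < (star (X.ballCoord (xm 1)) ⬝ᵥ (J *ᵥ X.ballCoord (xm 1))).re)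
    {ν R r gs L0 L1 : ℝ} (hν0 : 0 < ν) (hR0 : 0 < R) (hgs0 : 0 < gs)
    (hR2 : ν * R ^ 2 = r ^ 2) {z : Fin 2 → ℂ} (hg0 : 0 < 1 - nsq z) (hgz : gs / 2 ≤ 1 - nsq z)
    (hf0 : ‖star (lift3 z) ⬝ᵥ (J *ᵥ X.ballCoord (xm 0))‖ ≤ R * L0)
    (hf1 : ‖star (lift3 z) ⬝ᵥ (J *ᵥ X.ballCoord (xm 1))‖ ≤ R * L1) :
    ν * X.redMaj xm 0 z + ν * X.redMaj xm 1 z ≤ 4 * r ^ 2 * (L0 ^ 2 + L1 ^ 2) / gs := by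
  rw [X.redMaj_eq xm 0 hp0, X.redMaj_eq xm 1 hp1]
  have h5 : ‖star (lift3 z) ⬝ᵥ (J *ᵥ X.ballCoord (xm 0))‖ ^ 2 ≤ R ^ 2 * L0 ^ 2 := by
    rw [← mul_pow]; gcongr
  have h6 : ‖star (lift3 z) ⬝ᵥ (J *ᵥ X.ballCoord (xm 1))‖ ^ 2 ≤ R ^ 2 * L1 ^ 2 := by
    rw [← mul_pow]; gcongr
  have hinv : 1 / (1 - nsq z) ≤ 2 / gs := by
    rw [div_le_div_iff₀ hg0 hgs0]
    linarith
  have hS : 0 ≤ ‖star (lift3 z) ⬝ᵥ (J *ᵥ X.ballCoord (xm 0))‖ ^ 2 +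
      ‖star (lift3 z) ⬝ᵥ (J *ᵥ X.ballCoord (xm 1))‖ ^ 2 := by positivity
  calc ν * (2 * ‖star (lift3 z) ⬝ᵥ (J *ᵥ X.ballCoord (xm 0))‖ ^ 2 / (1 - nsq z)) +
        ν * (2 * ‖star (lift3 z) ⬝ᵥ (J *ᵥ X.ballCoord (xm 1))‖ ^ 2 / (1 - nsq z))
      = 2 * ν * (‖star (lift3 z) ⬝ᵥ (J *ᵥ X.ballCoord (xm 0))‖ ^ 2 +
          ‖star (lift3 z) ⬝ᵥ (J *ᵥ X.ballCoord (xm 1))‖ ^ 2) * (1 / (1 - nsq z)) := by ring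
    _ ≤ 2 * ν * (R ^ 2 * L0 ^ 2 + R ^ 2 * L1 ^ 2) * (2 / gs) := by gcongr
    _ = 4 * (ν * R ^ 2) * (L0 ^ 2 + L1 ^ 2) / gs := by ring
    _ = 4 * r ^ 2 * (L0 ^ 2 + L1 ^ 2) / gs := by rw [hR2]

end T4Data

/-- The points of a dilate of the cone-annulus: sizes of `z − z*` and of the two linear forms. -/
theorem mem_dilate_coneAnn {y0 y1 : Fin 3 → ℂ} {zs : Fin 2 → ℂ}
    (hf0 : star (lift3 zs) ⬝ᵥ (J *ᵥ y0) = 0) (hf1 : star (lift3 zs) ⬝ᵥ (J *ᵥ y1) = 0) {κ R : ℝ} (hκ : 0 < κ)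
    (hR0 : 0 < R) {z : Fin 2 → ℂ} (hz : z ∈ dilate zs R (coneAnn y0 y1 κ)) :
    ‖z - zs‖ < R ∧ κ * R / 2 < ‖star (lift3 z) ⬝ᵥ (J *ᵥ y0)‖ ∧ κ * R / 2 < ‖star (lift3 z) ⬝ᵥ (J *ᵥ y1)‖ ∧
      ‖star (lift3 z) ⬝ᵥ (J *ᵥ y0)‖ ≤ R * (‖y0 0‖ + ‖y0 1‖) ∧
      ‖star (lift3 z) ⬝ᵥ (J *ᵥ y1)‖ ≤ R * (‖y1 0‖ + ‖y1 1‖) := by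
  rw [mem_dilate] at hz
  obtain ⟨hh1, hh2, hh3, hh4⟩ := hz
  have hzh : z - zs = (R : ℂ) • (((R⁻¹ : ℝ) : ℂ) • (z - zs)) := sub_eq_smul_inv_smul hR0 zs z
  have hR' : ‖(R : ℂ)‖ = R := by rw [Complex.norm_real, Real.norm_eq_abs, abs_of_pos hR0]
  have hnorm : ‖z - zs‖ = R * ‖((R⁻¹ : ℝ) : ℂ) • (z - zs)‖ := by
    conv_lhs => rw [hzh]
    rw [norm_smul, hR']
  have hf0z : star (lift3 z) ⬝ᵥ (J *ᵥ y0) = (R : ℂ) * linPart y0 (((R⁻¹ : ℝ) : ℂ) • (z - zs)) := by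
    rw [jform_lift3_eq_linPart y0 hf0]
    conv_lhs => rw [hzh]
    rw [linPart_real_smul]
  have hf1z : star (lift3 z) ⬝ᵥ (J *ᵥ y1) = (R : ℂ) * linPart y1 (((R⁻¹ : ℝ) : ℂ) • (z - zs)) := by
    rw [jform_lift3_eq_linPart y1 hf1]
    conv_lhs => rw [hzh]
    rw [linPart_real_smul]
  refine ⟨?_, ?_, ?_, ?_, ?_⟩
  · rw [hnorm]; nlinarith
  · rw [hf0z, norm_mul, hR']
    have : κ * (1 / 2) < ‖linPart y0 (((R⁻¹ : ℝ) : ℂ) • (z - zs))‖ := by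
      calc κ * (1 / 2) ≤ κ * ‖((R⁻¹ : ℝ) : ℂ) • (z - zs)‖ := mul_le_mul_of_nonneg_left hh1.le hκ.le
        _ < _ := hh3
    calc κ * R / 2 = R * (κ * (1 / 2)) := by ring
      _ < R * ‖linPart y0 (((R⁻¹ : ℝ) : ℂ) • (z - zs))‖ := mul_lt_mul_of_pos_left this hR0
  · rw [hf1z, norm_mul, hR']
    have : κ * (1 / 2) < ‖linPart y1 (((R⁻¹ : ℝ) : ℂ) • (z - zs))‖ := by
      calc κ * (1 / 2) ≤ κ * ‖((R⁻¹ : ℝ) : ℂ) • (z - zs)‖ := mul_le_mul_of_nonneg_left hh1.le hκ.le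
        _ < _ := hh4
    calc κ * R / 2 = R * (κ * (1 / 2)) := by ring
      _ < R * ‖linPart y1 (((R⁻¹ : ℝ) : ℂ) • (z - zs))‖ := mul_lt_mul_of_pos_left this hR0
  · rw [hf0z, norm_mul, hR']
    apply mul_le_mul_of_nonneg_left _ hR0.le
    calc ‖linPart y0 _‖ ≤ (‖y0 0‖ + ‖y0 1‖) * ‖((R⁻¹ : ℝ) : ℂ) • (z - zs)‖ := norm_linPart_le y0 _
      _ ≤ (‖y0 0‖ + ‖y0 1‖) * 1 := by gcongr
      _ = ‖y0 0‖ + ‖y0 1‖ := by ring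
  · rw [hf1z, norm_mul, hR']
    apply mul_le_mul_of_nonneg_left _ hR0.le
    calc ‖linPart y1 _‖ ≤ (‖y1 0‖ + ‖y1 1‖) * ‖((R⁻¹ : ℝ) : ℂ) • (z - zs)‖ := norm_linPart_le y1 _
      _ ≤ (‖y1 0‖ + ‖y1 1‖) * 1 := by gcongr
      _ = ‖y1 0‖ + ‖y1 1‖ := by ring

namespace T4Data

variable (X : T4Data)

/-- **THE LOWER LAPLACE BOUND** at a symmetric `J`-positive centre with independent first coordinates:
`∃ c > 0, KMLaplaceLower X xm c`. -/
theorem kmLaplaceLower_of_centre (xm : X.Tuple) (h02 : xm 2 = xm 0) (h13 : xm 3 = xm 1)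
    (hab : X.ballCoord (xm 0) 0 * X.ballCoord (xm 1) 1 - X.ballCoord (xm 0) 1 * X.ballCoord (xm 1) 0 ≠ 0)
    (hpos : ∀ u v : ℂ, (u ≠ 0 ∨ v ≠ 0) →
      0 < (star (u • X.ballCoord (xm 0) + v • X.ballCoord (xm 1)) ⬝ᵥ
        (J *ᵥ (u • X.ballCoord (xm 0) + v • X.ballCoord (xm 1)))).re) :
    ∃ c : ℝ, 0 < c ∧ X.KMLaplaceLower xm c := by
  have hp0 : 0 < (star (X.ballCoord (xm 0)) ⬝ᵥ (J *ᵥ X.ballCoord (xm 0))).re := by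
    simpa using hpos 1 0 (Or.inl one_ne_zero)
  have hp1 : 0 < (star (X.ballCoord (xm 1)) ⬝ᵥ (J *ᵥ X.ballCoord (xm 1))).re := by
    simpa using hpos 0 1 (Or.inr one_ne_zero)
  obtain ⟨zs, hzs, hf0, hf1⟩ := exists_jOrth_point hab hpos
  have hnzs : nsq zs < 1 := hzs
  have hgs0 : 0 < 1 - nsq zs := by linarith
  -- `W(z*) ≠ 0`
  have hWzs : wedge (kmLin (X.ballCoord (xm 0)) zs) (kmLin (X.ballCoord (xm 1)) zs) ≠ 0 := by
    rw [wedge_kmLin_of_jOrth hf0 hf1]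
    exact (map_ne_zero _).2 hab
  have hWn : 0 < ‖wedge (kmLin (X.ballCoord (xm 0)) zs) (kmLin (X.ballCoord (xm 1)) zs)‖ := norm_pos_iff.2 hWzs
  -- the two radii from continuity
  obtain ⟨r2, hr2, hW2⟩ := Metric.continuousAt_iff.1
    (continuousAt_wedge_kmLin (X.ballCoord (xm 0)) (X.ballCoord (xm 1)) hzs)
    (‖wedge (kmLin (X.ballCoord (xm 0)) zs) (kmLin (X.ballCoord (xm 1)) zs)‖ / 2) (by positivity)
  obtain ⟨r1, hr1, hn1⟩ := Metric.continuousAt_iff.1 continuous_nsq_low.continuousAt ((1 - nsq zs) / 2) (by positivity)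
  -- the cone-annulus
  obtain ⟨κ, hκ, hne⟩ := exists_coneAnn_nonempty hab
  have hV0 : 0 < (volume (coneAnn (X.ballCoord (xm 0)) (X.ballCoord (xm 1)) κ)).toReal :=
    ENNReal.toReal_pos (measure_coneAnn_pos _ _ κ hne).ne' (measure_coneAnn_lt_top _ _ κ).ne
  have hr0 : 0 < min r1 r2 := lt_min hr1 hr2
  have hL0 : 0 ≤ (‖X.ballCoord (xm 0) 0‖ + ‖X.ballCoord (xm 0) 1‖) ^ 2 +
      (‖X.ballCoord (xm 1) 0‖ + ‖X.ballCoord (xm 1) 1‖) ^ 2 := by positivity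
  have he00 : 0 < Real.exp (-(Real.pi * (4 * (min r1 r2) ^ 2 *
      ((‖X.ballCoord (xm 0) 0‖ + ‖X.ballCoord (xm 0) 1‖) ^ 2 +
        (‖X.ballCoord (xm 1) 0‖ + ‖X.ballCoord (xm 1) 1‖) ^ 2) / (1 - nsq zs)))) := Real.exp_pos _
  refine ⟨(κ / 2) ^ 4 *
    (‖wedge (kmLin (X.ballCoord (xm 0)) zs) (kmLin (X.ballCoord (xm 1)) zs)‖ ^ 2 / 4) *
    Real.exp (-(Real.pi * (4 * (min r1 r2) ^ 2 *
      ((‖X.ballCoord (xm 0) 0‖ + ‖X.ballCoord (xm 0) 1‖) ^ 2 +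
        (‖X.ballCoord (xm 1) 0‖ + ‖X.ballCoord (xm 1) 1‖) ^ 2) / (1 - nsq zs)))) *
    (volume (coneAnn (X.ballCoord (xm 0)) (X.ballCoord (xm 1)) κ)).toReal * (min r1 r2) ^ 8, by positivity, ?_⟩
  intro ν hν hint
  have hν0 : 0 < ν := by linarith
  have hsν : 1 ≤ Real.sqrt ν := by rw [Real.one_le_sqrt]; exact hν
  have hsν0 : 0 < Real.sqrt ν := by linarith
  have hR0 : 0 < min r1 r2 / Real.sqrt ν := by positivity
  have hRr : min r1 r2 / Real.sqrt ν ≤ min r1 r2 := by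
    rw [div_le_iff₀ hsν0]; nlinarith
  have hR2 : ν * (min r1 r2 / Real.sqrt ν) ^ 2 = (min r1 r2) ^ 2 := by
    rw [div_pow, Real.sq_sqrt hν0.le]
    field_simp
  -- the dilate `T`
  have hTopen : IsOpen (dilate zs (min r1 r2 / Real.sqrt ν) (coneAnn (X.ballCoord (xm 0)) (X.ballCoord (xm 1)) κ)) :=
    isOpen_dilate zs _ (isOpen_coneAnn _ _ κ)
  have hTvol := volume_dilate zs hR0 (coneAnn (X.ballCoord (xm 0)) (X.ballCoord (xm 1)) κ)
  -- on `T`: inside the ball, `g ≥ g*/2`, `|W|² ≥ |W z*|²/4`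
  have hTball : ∀ z ∈ dilate zs (min r1 r2 / Real.sqrt ν) (coneAnn (X.ballCoord (xm 0)) (X.ballCoord (xm 1)) κ),
      z ∈ ball ∧ (1 - nsq zs) / 2 ≤ 1 - nsq z ∧
        ‖wedge (kmLin (X.ballCoord (xm 0)) zs) (kmLin (X.ballCoord (xm 1)) zs)‖ ^ 2 / 4 ≤
          ‖wedge (kmLin (X.ballCoord (xm 0)) z) (kmLin (X.ballCoord (xm 1)) z)‖ ^ 2 := by
    intro z hz
    have hd : dist z zs < min r1 r2 := by
      rw [dist_eq_norm]
      exact lt_of_lt_of_le (mem_dilate_coneAnn hf0 hf1 hκ hR0 hz).1 hRr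
    have hn := hn1 (lt_of_lt_of_le hd (min_le_left _ _))
    rw [Real.dist_eq, abs_lt] at hn
    obtain ⟨hn1', hn2'⟩ := hn
    have hW := hW2 (lt_of_lt_of_le hd (min_le_right _ _))
    rw [dist_eq_norm] at hW
    have hWz : ‖wedge (kmLin (X.ballCoord (xm 0)) zs) (kmLin (X.ballCoord (xm 1)) zs)‖ / 2 ≤
        ‖wedge (kmLin (X.ballCoord (xm 0)) z) (kmLin (X.ballCoord (xm 1)) z)‖ := by
      have := norm_sub_norm_le (wedge (kmLin (X.ballCoord (xm 0)) zs) (kmLin (X.ballCoord (xm 1)) zs))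
        (wedge (kmLin (X.ballCoord (xm 0)) z) (kmLin (X.ballCoord (xm 1)) z))
      rw [norm_sub_rev] at this
      linarith
    refine ⟨?_, by linarith, ?_⟩
    · show nsq z < 1
      linarith
    · calc ‖wedge (kmLin (X.ballCoord (xm 0)) zs) (kmLin (X.ballCoord (xm 1)) zs)‖ ^ 2 / 4 =
          (‖wedge (kmLin (X.ballCoord (xm 0)) zs) (kmLin (X.ballCoord (xm 1)) zs)‖ / 2) ^ 2 := by ring
        _ ≤ _ := by gcongr
  have hTsub : dilate zs (min r1 r2 / Real.sqrt ν) (coneAnn (X.ballCoord (xm 0)) (X.ballCoord (xm 1)) κ) ⊆ ball :=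
    fun z hz => (hTball z hz).1
  -- the pointwise lower bound on `T`
  have hlow : ∀ z ∈ dilate zs (min r1 r2 / Real.sqrt ν) (coneAnn (X.ballCoord (xm 0)) (X.ballCoord (xm 1)) κ),
      (κ * (min r1 r2 / Real.sqrt ν) / 2) ^ 4 *
        (‖wedge (kmLin (X.ballCoord (xm 0)) zs) (kmLin (X.ballCoord (xm 1)) zs)‖ ^ 2 / 4) *
        Real.exp (-(Real.pi * (4 * (min r1 r2) ^ 2 *
          ((‖X.ballCoord (xm 0) 0‖ + ‖X.ballCoord (xm 0) 1‖) ^ 2 +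
            (‖X.ballCoord (xm 1) 0‖ + ‖X.ballCoord (xm 1) 1‖) ^ 2) / (1 - nsq zs)))) ≤
        X.kmDilInt xm ν ν z := by
    intro z hz
    obtain ⟨hz1, hz3, hz4, hz5, hz6⟩ := mem_dilate_coneAnn hf0 hf1 hκ hR0 hz
    obtain ⟨hzb, hgz, hWz⟩ := hTball z hz
    have hg0 : 0 < 1 - nsq z := by linarith
    have hg1 : 1 - nsq z ≤ 1 := by
      have : 0 ≤ nsq z := by unfold nsq; positivity
      linarith
    refine X.kmDilInt_ge xm h02 h13 ν z hg0 hg1 (by positivity) he00.le ?_ ?_ ?_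
    · rw [map_mul, Complex.normSq_eq_norm_sq, Complex.normSq_eq_norm_sq]
      have hκR : 0 ≤ κ * (min r1 r2 / Real.sqrt ν) / 2 := by positivity
      calc (κ * (min r1 r2 / Real.sqrt ν) / 2) ^ 4 =
          (κ * (min r1 r2 / Real.sqrt ν) / 2) ^ 2 * (κ * (min r1 r2 / Real.sqrt ν) / 2) ^ 2 := by ring
        _ ≤ _ := by gcongr
    · rw [Complex.normSq_eq_norm_sq]; exact hWz
    · apply Real.exp_le_exp.2
      have := X.exp_bound_of_dilate xm hp0 hp1 hν0 hR0 hgs0 hR2 hg0 hgz hz5 hz6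
      exact neg_le_neg (mul_le_mul_of_nonneg_left this Real.pi_pos.le)
  -- integrate over `T`
  have hTmeas : MeasurableSet (dilate zs (min r1 r2 / Real.sqrt ν)
      (coneAnn (X.ballCoord (xm 0)) (X.ballCoord (xm 1)) κ)) := hTopen.measurableSet
  have hTfin : volume (dilate zs (min r1 r2 / Real.sqrt ν) (coneAnn (X.ballCoord (xm 0)) (X.ballCoord (xm 1)) κ))
      ≠ ⊤ := by
    rw [hTvol]
    exact ENNReal.mul_ne_top ENNReal.ofReal_ne_top (measure_coneAnn_lt_top _ _ κ).ne
  have h1 := setIntegral_ge_of_const_le hTmeas hTfin hlow (hint.mono_set hTsub)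
  have h2 : ∫ z in dilate zs (min r1 r2 / Real.sqrt ν) (coneAnn (X.ballCoord (xm 0)) (X.ballCoord (xm 1)) κ),
      X.kmDilInt xm ν ν z ≤ ∫ z in ball, X.kmDilInt xm ν ν z :=
    setIntegral_mono_set hint (Filter.Eventually.of_forall fun z => X.kmDilInt_nonneg xm h02 h13 ν ν z)
      (Filter.Eventually.of_forall hTsub)
  have hvolT : (volume (dilate zs (min r1 r2 / Real.sqrt ν)
      (coneAnn (X.ballCoord (xm 0)) (X.ballCoord (xm 1)) κ))).toReal =
      (min r1 r2 / Real.sqrt ν) ^ 4 * (volume (coneAnn (X.ballCoord (xm 0)) (X.ballCoord (xm 1)) κ)).toReal := by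
    rw [hTvol, ENNReal.toReal_mul, ENNReal.toReal_ofReal (by positivity)]
  have hR8 : (min r1 r2 / Real.sqrt ν) ^ 8 = (min r1 r2) ^ 8 * ν ^ (-4 : ℝ) := by
    have hs2 : Real.sqrt ν ^ 2 = ν := Real.sq_sqrt hν0.le
    have h8 : (min r1 r2 / Real.sqrt ν) ^ 8 = (min r1 r2) ^ 8 / ν ^ 4 := by
      rw [div_pow, show (8 : ℕ) = 2 * 4 from rfl, pow_mul, pow_mul, hs2]
    rw [h8, Real.rpow_neg hν0.le, show (4 : ℝ) = ((4 : ℕ) : ℝ) by norm_num, Real.rpow_natCast]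
    ring
  unfold kmJ
  rw [measureReal_def, smul_eq_mul, hvolT] at h1
  have hfinal : (κ / 2) ^ 4 *
      (‖wedge (kmLin (X.ballCoord (xm 0)) zs) (kmLin (X.ballCoord (xm 1)) zs)‖ ^ 2 / 4) *
      Real.exp (-(Real.pi * (4 * (min r1 r2) ^ 2 *
        ((‖X.ballCoord (xm 0) 0‖ + ‖X.ballCoord (xm 0) 1‖) ^ 2 +
          (‖X.ballCoord (xm 1) 0‖ + ‖X.ballCoord (xm 1) 1‖) ^ 2) / (1 - nsq zs)))) *
      (volume (coneAnn (X.ballCoord (xm 0)) (X.ballCoord (xm 1)) κ)).toReal * (min r1 r2) ^ 8 * ν ^ (-4 : ℝ) =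
      (min r1 r2 / Real.sqrt ν) ^ 4 * (volume (coneAnn (X.ballCoord (xm 0)) (X.ballCoord (xm 1)) κ)).toReal *
        ((κ * (min r1 r2 / Real.sqrt ν) / 2) ^ 4 *
          (‖wedge (kmLin (X.ballCoord (xm 0)) zs) (kmLin (X.ballCoord (xm 1)) zs)‖ ^ 2 / 4) *
          Real.exp (-(Real.pi * (4 * (min r1 r2) ^ 2 *
            ((‖X.ballCoord (xm 0) 0‖ + ‖X.ballCoord (xm 0) 1‖) ^ 2 +
              (‖X.ballCoord (xm 1) 0‖ + ‖X.ballCoord (xm 1) 1‖) ^ 2) / (1 - nsq zs))))) := by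
    rw [mul_assoc _ ((min r1 r2) ^ 8) _, ← hR8]
    ring
  rw [hfinal]
  exact h1.trans h2


/-- **THE CUT FROM THE UPPER LAPLACE BOUND ALONE**: at a symmetric `J`-positive centre with independent first coordinates,
`hkRed_ray` for every `D : X.ThetaData` follows from `∃ C p, 4 ≤ p ∧ KMLaplaceUpper xm C p` (the lower bound is a
theorem). -/
theorem hkRed_ray_of_laplaceUpper (D : X.ThetaData) (xm : X.Tuple) (h02 : xm 2 = xm 0) (h13 : xm 3 = xm 1)
    (hab : X.ballCoord (xm 0) 0 * X.ballCoord (xm 1) 1 - X.ballCoord (xm 0) 1 * X.ballCoord (xm 1) 0 ≠ 0)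
    (hpos : ∀ u v : ℂ, (u ≠ 0 ∨ v ≠ 0) →
      0 < (star (u • X.ballCoord (xm 0) + v • X.ballCoord (xm 1)) ⬝ᵥ
        (J *ᵥ (u • X.ballCoord (xm 0) + v • X.ballCoord (xm 1)))).re)
    (hU : ∃ C p : ℝ, 4 ≤ p ∧ X.KMLaplaceUpper xm C p) :
    ∃ A k : ℝ, 0 ≤ A ∧ 0 ≤ k ∧ ∀ n : ℕ, 1 ≤ n → X.MajorantMomentBoundRed D (X.rayCentre xm n) A k := by
  obtain ⟨C, p, hp, hUp⟩ := hU
  obtain ⟨c, hc, hL⟩ := X.kmLaplaceLower_of_centre xm h02 h13 hab hpos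
  exact X.hkRed_ray_of_laplace D xm h02 h13 ⟨C, p, c, hp, hUp, hc, hL⟩

end T4Data

end Summit.Ventures.HodgeRepro.Tier4.Line3

end
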